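import Summits.AtomisticToContinuum.HydrodynamicLimit.Theses.WarmColdDichotomy
import Summits.AtomisticToContinuum.HydrodynamicLimit.Theorems.OneFlightGossipEngineEnergyCurrentTailsQuarticDocking
import Summits.AtomisticToContinuum.HydrodynamicLimit.Theorems.OneFlightGossipEngineEnergyCurrentTailsPedigreeObjects
import Literature.MathematicalPhysics.KineticTheory.HardSphereEulerProofs
import HarnessLib

/-!
# Census docking of the line `pedigree-perpetuity` (crux `EnergyCurrentTails`, stmt-AtomisticToContinuum-9235)

Registered stub `stub_censusDocking : CensusDecay → WarmColdDichotomy.EnergyCurrentTails` (CLOSED in the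
skeleton `Cruxes/EnergyCurrentTails/Lines/pedigree_perpetuity.lean` §4b; lead c3,
`prover-line-stmt-AtomisticToContinuum-9235-c3-0`), landed over the vocabulary file
`…Theorems.OneFlightGossipEngineEnergyCurrentTailsPedigreeObjects`:

* the discrete layer cake for the quartic, `‖v‖⁴ ≤ Θ² + Σ_j (2j+3) Θ² 𝟙{(j+1)Θ ≤ ‖v‖²}`
  (`quartic_le_levels`);
* `CensusDecay` (expected level census `≤ B(N+1)L⁻⁴`) therefore gives the `N`-uniform EMPIRICAL QUARTIC
  MOMENT `E[(N+1)⁻¹ Σᵢ ‖vᵢ(s)‖⁴] ≤ Θ² + Σ_j (2j+3)Θ² B⁺/(j+1)⁴` (`quarticMoment_of_censusDecay`: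
  `lintegral_tsum`, `ENNReal.tsum_comm`, the p-series);
* the landed Chebyshev docking `…Theorems.LoschmidtTagging.stub_quarticDocking` (p92098) concludes the
  crux — its `OneFlightGossipEngine` copy, which is the primary `WarmColdDichotomy` copy by `rfl` of the
  two route definitions (`stub_censusDocking`, `censusDocking_oneFlight`).
-/

noncomputable section

open MeasureTheory Set Filter
open scoped ENNReal InnerProductSpace BigOperators

namespace Summit.AtomisticToContinuum.HydrodynamicLimit.Theorems.EnergyCurrentTailsPedigree

open Literature.MathematicalPhysics.KineticTheory Literature.Analysis.FluidPDE

/-- `Σ_{j<K} (2j+3) = K² + 2K`. -/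
theorem sum_range_two_mul_add_three (K : ℕ) :
    ∑ j ∈ Finset.range K, (2 * (j : ℝ) + 3) = (K : ℝ) ^ 2 + 2 * K := by
  induction K with
  | zero => simp
  | succ K ih => rw [Finset.sum_range_succ, ih]; push_cast; ring

/-- **Discrete layer cake for the quartic**: `‖v‖⁴ ≤ Θ² + Σ_j (2j+3)Θ²·𝟙{(j+1)Θ ≤ ‖v‖²}`. -/
theorem quartic_le_levels {Θ : ℝ} (hΘ : 0 < Θ) (v : V3) :
    ENNReal.ofReal (‖v‖ ^ 4) ≤ ENNReal.ofReal (Θ ^ 2) +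
      ∑' j : ℕ, ENNReal.ofReal ((2 * (j : ℝ) + 3) * Θ ^ 2) *
        Set.indicator {w : V3 | ((j + 1 : ℕ) : ℝ) * Θ ≤ ‖w‖ ^ 2} (fun _ => (1 : ℝ≥0∞)) v := by
  set K := ⌊‖v‖ ^ 2 / Θ⌋₊ with hK
  have hx : 0 ≤ ‖v‖ ^ 2 / Θ := by positivity
  have hK1 : ‖v‖ ^ 2 < ((K : ℝ) + 1) * Θ := by
    have h := Nat.lt_floor_add_one (‖v‖ ^ 2 / Θ)
    rwa [div_lt_iff₀ hΘ] at h
  have hK2 : ∀ j, j < K → ((j + 1 : ℕ) : ℝ) * Θ ≤ ‖v‖ ^ 2 := by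
    intro j hj
    have h1 : ((j + 1 : ℕ) : ℝ) ≤ (K : ℝ) := by exact_mod_cast hj
    have h2 : (K : ℝ) ≤ ‖v‖ ^ 2 / Θ := Nat.floor_le hx
    have h3 : ((j + 1 : ℕ) : ℝ) ≤ ‖v‖ ^ 2 / Θ := h1.trans h2
    rwa [le_div_iff₀ hΘ] at h3
  -- the real inequality
  have hreal : ‖v‖ ^ 4 ≤ Θ ^ 2 + ∑ j ∈ Finset.range K, (2 * (j : ℝ) + 3) * Θ ^ 2 := by
    have hsum : ∑ j ∈ Finset.range K, (2 * (j : ℝ) + 3) * Θ ^ 2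
        = ((K : ℝ) ^ 2 + 2 * K) * Θ ^ 2 := by
      rw [← Finset.sum_mul, sum_range_two_mul_add_three]
    rw [hsum]
    have h4 : ‖v‖ ^ 4 = (‖v‖ ^ 2) ^ 2 := by ring
    have h5 : (‖v‖ ^ 2) ^ 2 ≤ (((K : ℝ) + 1) * Θ) ^ 2 :=
      pow_le_pow_left₀ (by positivity) hK1.le 2
    rw [h4]
    nlinarith [h5]
  have hterm : ∀ j ∈ Finset.range K,
      ENNReal.ofReal ((2 * (j : ℝ) + 3) * Θ ^ 2)
        = ENNReal.ofReal ((2 * (j : ℝ) + 3) * Θ ^ 2) *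
          Set.indicator {w : V3 | ((j + 1 : ℕ) : ℝ) * Θ ≤ ‖w‖ ^ 2} (fun _ => (1 : ℝ≥0∞)) v := by
    intro j hj
    rw [Set.indicator_of_mem (show v ∈ {w : V3 | ((j + 1 : ℕ) : ℝ) * Θ ≤ ‖w‖ ^ 2} from
      hK2 j (Finset.mem_range.1 hj)), mul_one]
  calc ENNReal.ofReal (‖v‖ ^ 4)
      ≤ ENNReal.ofReal (Θ ^ 2 + ∑ j ∈ Finset.range K, (2 * (j : ℝ) + 3) * Θ ^ 2) :=
        ENNReal.ofReal_le_ofReal hreal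
    _ = ENNReal.ofReal (Θ ^ 2) + ∑ j ∈ Finset.range K, ENNReal.ofReal ((2 * (j : ℝ) + 3) * Θ ^ 2) := by
        rw [ENNReal.ofReal_add (by positivity) (Finset.sum_nonneg fun j _ => by positivity),
          ENNReal.ofReal_sum_of_nonneg fun j _ => by positivity]
    _ = ENNReal.ofReal (Θ ^ 2) + ∑ j ∈ Finset.range K, ENNReal.ofReal ((2 * (j : ℝ) + 3) * Θ ^ 2) *
          Set.indicator {w : V3 | ((j + 1 : ℕ) : ℝ) * Θ ≤ ‖w‖ ^ 2} (fun _ => (1 : ℝ≥0∞)) v := by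
        rw [Finset.sum_congr rfl hterm]
    _ ≤ _ := by
        gcongr
        exact ENNReal.sum_le_tsum _

/-- **`CensusDecay` gives the uniform empirical QUARTIC moment bound** (the hypothesis of the landed
`Theorems.LoschmidtTagging.stub_quarticDocking`): `E[(N+1)⁻¹ Σᵢ ‖vᵢ(s)‖⁴] ≤ Θ² + Σ_j (2j+3)Θ²B⁺/(j+1)⁴`. -/
theorem quarticMoment_of_censusDecay (hC : CensusDecay) :
    ∀ (a₀ θ₀ : T3 → ℝ) (u₀ : T3 → V3), Continuous a₀ → Continuous θ₀ → Continuous u₀ →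
      (∀ x, 0 < a₀ x) → (∀ x, 0 < θ₀ x) → ∃ σ₀ : ℝ, 0 < σ₀ ∧ ∀ σ : ℝ, 0 < σ → σ < σ₀ →
      ∀ (T : ℝ) (ρ θ : ℝ → T3 → ℝ) (u : ℝ → T3 → V3), IsHardSphereEulerSolution σ T ρ u θ →
      ∀ Φ : (N : ℕ) → HardSphereFlow (Torus.geometry (Fin 3)) (hsDiameter σ N) (N + 1),
      TendstoHydroFieldsAt (fun N => localGibbsLaw σ a₀ u₀ θ₀ N (Φ N)) Φ ρ u θ 0 →
      ∀ t ∈ Set.Ico 0 T, ∃ C : ℝ, ∃ N₀ : ℕ, ∀ N : ℕ, N₀ ≤ N → ∀ s ∈ Set.Icc 0 t,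
        ∫⁻ z, ENNReal.ofReal (((N : ℝ) + 1)⁻¹ * ∑ i : Fin (N + 1), ‖((Φ N).flow s z i).2‖ ^ 4)
          ∂(localGibbsLaw σ a₀ u₀ θ₀ N (Φ N)) ≤ ENNReal.ofReal C := by
  intro a₀ θ₀ u₀ ha hθ hu ha0 hθ0
  obtain ⟨σ₀, hσ₀, H⟩ := hC a₀ θ₀ u₀ ha hθ hu ha0 hθ0
  refine ⟨min σ₀ (1 / 2), lt_min hσ₀ (by norm_num), ?_⟩
  intro σ hσ hσlt T ρ θ u hE Φ h0 t ht
  have hσ₀' : σ < σ₀ := lt_of_lt_of_le hσlt (min_le_left _ _)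
  have hσ2 : σ ≤ 1 / 2 := (lt_of_lt_of_le hσlt (min_le_right _ _)).le
  obtain ⟨Θ, hΘ, B, N₀, HN⟩ := H σ hσ hσ₀' T ρ θ u hE Φ h0 t ht
  -- the real constants
  set b : ℕ → ℝ := fun j => (2 * (j : ℝ) + 3) * Θ ^ 2 * (max B 0 / ((j + 1 : ℕ) : ℝ) ^ 4) with hb
  have hb0 : ∀ j, 0 ≤ b j := fun j => by positivity
  have hbs : Summable b := by
    -- `b j ≤ 3 Θ² B⁺ · (1/(j+1))^3 ≤ …`; compare with the shifted p-series `1/(j+1)^2`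
    have hp : Summable (fun j : ℕ => 1 / ((j + 1 : ℕ) : ℝ) ^ 2) := by
      have h2 : Summable (fun n : ℕ => 1 / (n : ℝ) ^ 2) := Real.summable_one_div_nat_pow.2 one_lt_two
      exact (summable_nat_add_iff 1).2 h2
    refine Summable.of_nonneg_of_le hb0 (fun j => ?_) (hp.mul_left (3 * Θ ^ 2 * max B 0))
    have hj0 : (0 : ℝ) < ((j + 1 : ℕ) : ℝ) := by positivity
    have hΘB : 0 ≤ Θ ^ 2 * max B 0 := by positivity
    have key : (2 * (j : ℝ) + 3) / ((j + 1 : ℕ) : ℝ) ^ 4 ≤ 3 / ((j + 1 : ℕ) : ℝ) ^ 2 := by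
      rw [div_le_div_iff₀ (by positivity) (by positivity)]
      have h3 : 2 * (j : ℝ) + 3 ≤ 3 * ((j + 1 : ℕ) : ℝ) ^ 2 := by
        push_cast; nlinarith [sq_nonneg (j : ℝ), (Nat.cast_nonneg j : (0 : ℝ) ≤ j)]
      have h4 : 0 ≤ ((j + 1 : ℕ) : ℝ) ^ 2 := by positivity
      calc (2 * (j : ℝ) + 3) * ((j + 1 : ℕ) : ℝ) ^ 2 ≤ (3 * ((j + 1 : ℕ) : ℝ) ^ 2) * ((j + 1 : ℕ) : ℝ) ^ 2 :=
            mul_le_mul_of_nonneg_right h3 h4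
        _ = 3 * ((j + 1 : ℕ) : ℝ) ^ 4 := by ring
    have hbj : b j = Θ ^ 2 * max B 0 * ((2 * (j : ℝ) + 3) / ((j + 1 : ℕ) : ℝ) ^ 4) := by
      rw [hb]; simp only; ring
    rw [hbj]
    calc Θ ^ 2 * max B 0 * ((2 * (j : ℝ) + 3) / ((j + 1 : ℕ) : ℝ) ^ 4)
        ≤ Θ ^ 2 * max B 0 * (3 / ((j + 1 : ℕ) : ℝ) ^ 2) := mul_le_mul_of_nonneg_left key hΘB
      _ = 3 * Θ ^ 2 * max B 0 * (1 / ((j + 1 : ℕ) : ℝ) ^ 2) := by ring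
  refine ⟨Θ ^ 2 + ∑' j, b j, N₀, fun N hN s hs => ?_⟩
  haveI := isProbabilityMeasure_localGibbsLaw ha hθ hu ha0 hθ0 hσ2 N (Φ N)
  set P := localGibbsLaw σ a₀ u₀ θ₀ N (Φ N) with hP
  -- measurability
  have hvel : ∀ i : Fin (N + 1), Measurable fun z : Config (N + 1) (Fin 3) T3 => ((Φ N).flow s z i).2 :=
    fun i => measurable_snd.comp ((measurable_pi_apply i).comp ((Φ N).measurable_flow s))
  have hvel4 : ∀ i : Fin (N + 1), Measurable fun z : Config (N + 1) (Fin 3) T3 =>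
      ENNReal.ofReal (‖((Φ N).flow s z i).2‖ ^ 4) :=
    fun i => (measurable_norm.pow_const 4).ennreal_ofReal.comp (hvel i)
  have hind : ∀ (i : Fin (N + 1)) (j : ℕ), Measurable fun z : Config (N + 1) (Fin 3) T3 =>
      Set.indicator {w : V3 | ((j + 1 : ℕ) : ℝ) * Θ ≤ ‖w‖ ^ 2} (fun _ => (1 : ℝ≥0∞))
        (((Φ N).flow s z i).2) := by
    intro i j
    refine (Measurable.indicator measurable_const ?_).comp (hvel i)
    exact measurableSet_le measurable_const (measurable_norm.pow_const 2)
  -- census bound for the shifted levels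
  have hcen : ∀ j : ℕ, census σ a₀ θ₀ u₀ N (Φ N) s (((j + 1 : ℕ) : ℝ) * Θ)
      ≤ ENNReal.ofReal (max B 0 * ((N : ℝ) + 1) / ((j + 1 : ℕ) : ℝ) ^ 4) := by
    intro j
    refine (HN N hN s hs (j + 1) (Nat.succ_le_succ (Nat.zero_le j))).trans ?_
    refine ENNReal.ofReal_le_ofReal (div_le_div_of_nonneg_right ?_ (by positivity))
    exact mul_le_mul_of_nonneg_right (le_max_left _ _) (by positivity)
  -- per particle: integrate the layer cake
  have hpart : (∑ i : Fin (N + 1), ∫⁻ z, ENNReal.ofReal (‖((Φ N).flow s z i).2‖ ^ 4) ∂P)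
      ≤ ((N + 1 : ℕ) : ℝ≥0∞) * ENNReal.ofReal (Θ ^ 2)
        + ∑' j : ℕ, ENNReal.ofReal ((2 * (j : ℝ) + 3) * Θ ^ 2)
            * census σ a₀ θ₀ u₀ N (Φ N) s (((j + 1 : ℕ) : ℝ) * Θ) := by
    have h1 : ∀ i : Fin (N + 1), ∫⁻ z, ENNReal.ofReal (‖((Φ N).flow s z i).2‖ ^ 4) ∂P
        ≤ ENNReal.ofReal (Θ ^ 2) + ∑' j : ℕ, ENNReal.ofReal ((2 * (j : ℝ) + 3) * Θ ^ 2) *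
            ∫⁻ z, Set.indicator {w : V3 | ((j + 1 : ℕ) : ℝ) * Θ ≤ ‖w‖ ^ 2} (fun _ => (1 : ℝ≥0∞))
              (((Φ N).flow s z i).2) ∂P := by
      intro i
      calc ∫⁻ z, ENNReal.ofReal (‖((Φ N).flow s z i).2‖ ^ 4) ∂P
          ≤ ∫⁻ z, (ENNReal.ofReal (Θ ^ 2) + ∑' j : ℕ, ENNReal.ofReal ((2 * (j : ℝ) + 3) * Θ ^ 2) *
              Set.indicator {w : V3 | ((j + 1 : ℕ) : ℝ) * Θ ≤ ‖w‖ ^ 2} (fun _ => (1 : ℝ≥0∞))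
                (((Φ N).flow s z i).2)) ∂P := lintegral_mono fun z => quartic_le_levels hΘ _
        _ = ENNReal.ofReal (Θ ^ 2) * P Set.univ + ∑' j : ℕ, ∫⁻ z, ENNReal.ofReal ((2 * (j : ℝ) + 3) * Θ ^ 2) *
              Set.indicator {w : V3 | ((j + 1 : ℕ) : ℝ) * Θ ≤ ‖w‖ ^ 2} (fun _ => (1 : ℝ≥0∞))
                (((Φ N).flow s z i).2) ∂P := by
            rw [lintegral_add_left measurable_const, lintegral_const,
              lintegral_tsum fun j => ((hind i j).const_mul _).aemeasurable]
        _ = _ := by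
            rw [measure_univ, mul_one]
            congr 1
            refine tsum_congr fun j => ?_
            rw [lintegral_const_mul _ (hind i j)]
    calc (∑ i : Fin (N + 1), ∫⁻ z, ENNReal.ofReal (‖((Φ N).flow s z i).2‖ ^ 4) ∂P)
        ≤ ∑ i : Fin (N + 1), (ENNReal.ofReal (Θ ^ 2) + ∑' j : ℕ, ENNReal.ofReal ((2 * (j : ℝ) + 3) * Θ ^ 2) *
            ∫⁻ z, Set.indicator {w : V3 | ((j + 1 : ℕ) : ℝ) * Θ ≤ ‖w‖ ^ 2} (fun _ => (1 : ℝ≥0∞))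
              (((Φ N).flow s z i).2) ∂P) := Finset.sum_le_sum fun i _ => h1 i
      _ = ((N + 1 : ℕ) : ℝ≥0∞) * ENNReal.ofReal (Θ ^ 2)
          + ∑' j : ℕ, ENNReal.ofReal ((2 * (j : ℝ) + 3) * Θ ^ 2)
              * ∑ i : Fin (N + 1), ∫⁻ z, Set.indicator {w : V3 | ((j + 1 : ℕ) : ℝ) * Θ ≤ ‖w‖ ^ 2}
                  (fun _ => (1 : ℝ≥0∞)) (((Φ N).flow s z i).2) ∂P := by
          rw [Finset.sum_add_distrib, Finset.sum_const, Finset.card_univ, Fintype.card_fin, nsmul_eq_mul]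
          congr 1
          rw [← tsum_fintype (L := SummationFilter.unconditional _), ENNReal.tsum_comm]
          refine tsum_congr fun j => ?_
          rw [tsum_fintype, Finset.mul_sum]
      _ = _ := by
          congr 1
          refine tsum_congr fun j => ?_
          congr 1
          rw [← lintegral_finsetSum _ fun i _ => hind i j]
          rfl
  -- plug the census bound, sum the series
  have hser : (∑' j : ℕ, ENNReal.ofReal ((2 * (j : ℝ) + 3) * Θ ^ 2)
        * census σ a₀ θ₀ u₀ N (Φ N) s (((j + 1 : ℕ) : ℝ) * Θ))
      ≤ ENNReal.ofReal ((N : ℝ) + 1) * ENNReal.ofReal (∑' j, b j) := by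
    calc (∑' j : ℕ, ENNReal.ofReal ((2 * (j : ℝ) + 3) * Θ ^ 2)
          * census σ a₀ θ₀ u₀ N (Φ N) s (((j + 1 : ℕ) : ℝ) * Θ))
        ≤ ∑' j : ℕ, ENNReal.ofReal ((N : ℝ) + 1) * ENNReal.ofReal (b j) := by
          refine ENNReal.tsum_le_tsum fun j => ?_
          calc ENNReal.ofReal ((2 * (j : ℝ) + 3) * Θ ^ 2) * census σ a₀ θ₀ u₀ N (Φ N) s (((j + 1 : ℕ) : ℝ) * Θ)
              ≤ ENNReal.ofReal ((2 * (j : ℝ) + 3) * Θ ^ 2)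
                  * ENNReal.ofReal (max B 0 * ((N : ℝ) + 1) / ((j + 1 : ℕ) : ℝ) ^ 4) := by
                gcongr
                exact hcen j
            _ = ENNReal.ofReal ((N : ℝ) + 1) * ENNReal.ofReal (b j) := by
                rw [← ENNReal.ofReal_mul (by positivity), ← ENNReal.ofReal_mul (by positivity), hb]
                congr 1
                simp only
                ring
      _ = ENNReal.ofReal ((N : ℝ) + 1) * ENNReal.ofReal (∑' j, b j) := by
          rw [ENNReal.tsum_mul_left, ENNReal.ofReal_tsum_of_nonneg hb0 hbs]
  -- assemble
  have hpt : ∀ z : Config (N + 1) (Fin 3) T3,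
      ENNReal.ofReal (((N : ℝ) + 1)⁻¹ * ∑ i : Fin (N + 1), ‖((Φ N).flow s z i).2‖ ^ 4) =
        ENNReal.ofReal (((N : ℝ) + 1)⁻¹) *
          ∑ i : Fin (N + 1), ENNReal.ofReal (‖((Φ N).flow s z i).2‖ ^ 4) := by
    intro z
    rw [ENNReal.ofReal_mul (by positivity), ENNReal.ofReal_sum_of_nonneg fun i _ => by positivity]
  have hNN : ((N + 1 : ℕ) : ℝ≥0∞) = ENNReal.ofReal ((N : ℝ) + 1) := by
    rw [show ((N : ℝ) + 1) = ((N + 1 : ℕ) : ℝ) by push_cast; ring, ENNReal.ofReal_natCast]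
  have hN1 : ENNReal.ofReal (((N : ℝ) + 1)⁻¹) * ENNReal.ofReal ((N : ℝ) + 1) = 1 := by
    rw [← ENNReal.ofReal_mul (by positivity), inv_mul_cancel₀ (by positivity), ENNReal.ofReal_one]
  calc ∫⁻ z, ENNReal.ofReal (((N : ℝ) + 1)⁻¹ * ∑ i : Fin (N + 1), ‖((Φ N).flow s z i).2‖ ^ 4) ∂P
      = ∫⁻ z, ENNReal.ofReal (((N : ℝ) + 1)⁻¹) *
          ∑ i : Fin (N + 1), ENNReal.ofReal (‖((Φ N).flow s z i).2‖ ^ 4) ∂P := lintegral_congr fun z => hpt z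
    _ = ENNReal.ofReal (((N : ℝ) + 1)⁻¹) *
          ∫⁻ z, ∑ i : Fin (N + 1), ENNReal.ofReal (‖((Φ N).flow s z i).2‖ ^ 4) ∂P :=
        lintegral_const_mul _ (Finset.measurable_sum _ fun i _ => hvel4 i)
    _ = ENNReal.ofReal (((N : ℝ) + 1)⁻¹) *
          ∑ i : Fin (N + 1), ∫⁻ z, ENNReal.ofReal (‖((Φ N).flow s z i).2‖ ^ 4) ∂P := by
        congr 1
        exact lintegral_finsetSum _ fun i _ => hvel4 i
    _ ≤ ENNReal.ofReal (((N : ℝ) + 1)⁻¹) * (((N + 1 : ℕ) : ℝ≥0∞) * ENNReal.ofReal (Θ ^ 2)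
          + ENNReal.ofReal ((N : ℝ) + 1) * ENNReal.ofReal (∑' j, b j)) := by
        gcongr
        exact hpart.trans (add_le_add le_rfl hser)
    _ = ENNReal.ofReal (Θ ^ 2 + ∑' j, b j) := by
        rw [hNN, ← mul_add, ← mul_assoc, hN1, one_mul,
          ENNReal.ofReal_add (by positivity) (tsum_nonneg hb0)]

/-- **Registered stub `stub_censusDocking`** (CLOSED): the census decay C⁺ implies the crux
`WarmColdDichotomy.EnergyCurrentTails` BY NAME — uniform empirical quartic moment
(`quarticMoment_of_censusDecay`) followed by the landed Chebyshev docking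
`…Theorems.LoschmidtTagging.stub_quarticDocking` (which concludes the definitionally equal
`OneFlightGossipEngine` copy). -/
theorem stub_censusDocking :
    CensusDecay → Summit.AtomisticToContinuum.HydrodynamicLimit.Theses.WarmColdDichotomy.EnergyCurrentTails :=
  fun hC => Summit.AtomisticToContinuum.HydrodynamicLimit.Theorems.LoschmidtTagging.stub_quarticDocking
    (quarticMoment_of_censusDecay hC)

/-- The same docking, concluding the `OneFlightGossipEngine` copy of the crux (payload route of the line). -/
theorem censusDocking_oneFlight :
    CensusDecay → Summit.AtomisticToContinuum.HydrodynamicLimit.Theses.OneFlightGossipEngine.EnergyCurrentTails :=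
  fun hC => Summit.AtomisticToContinuum.HydrodynamicLimit.Theorems.LoschmidtTagging.stub_quarticDocking
    (quarticMoment_of_censusDecay hC)

end Summit.AtomisticToContinuum.HydrodynamicLimit.Theorems.EnergyCurrentTailsPedigree

end
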